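import Mathlib

/-!
# `BalabanUV.Beta.GAN24.AntisymmetricPairing` — binder row G-an2-4 ∕ (CONV-C), CT-W, the (DIV) row's located mechanism (leaf-01 g68 C-2 (3) ∕ C-3, journal l.46285 ∕ l.46384;
# the OWNER gan24-p1 g30's E33 ∕ R21–R22): **AN ANTISYMMETRIC KERNEL PAIRED WITH TWO LEGS IS A COMMUTATOR** — `2·Σ_{p,q} Φ(p,q)·L(p)·R(q) = Σ_{p,q} Φ(p,q)·(L(p)R(q) − L(q)R(p))`,
# hence the pairing vanishes for equal legs (the sandwich's diagonal — why CERT-SPEC §3 was void) and is bounded by the legs' MODULI OF VARIATION across the kernel's band: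
# `|Σ Φ L R| ≤ ½·Σ_{p,q} |Φ(p,q)|·(|L p − L q|·|R q| + |L q|·|R q − R p|)` — the derivative gain is exactly as large as the legs are smooth ACROSS THE PAIRS THE KERNEL COUPLES
# (parallel bonds: yes, by (N1′); perpendicular bonds: no a priori — C-3), stated here with free moduli so that either reading instantiates it
# (G-an2-4 formalisation swarm → CRUX TEAM (2), leaf prover `b2b-balaban-gan24-formalise-leaf-01`, gen 68; generic finite index types — bonds with their direction index are ONE index)

NOT IN PRINT; OUR BOOKKEEPING ([folklore] finite-sum algebra: `Finset.sum_comm`, the triangle inequality; 0 cited facts, 0 `def`, 0 `def … : Prop`, 0 sorry).  HONEST FRAMING (cell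
contract, verbatim): «discharging `BetaPertH` makes Bałaban's UV stability UNCONDITIONAL — a real constructive-QFT result; it is NOT the continuum limit and NOT the Clay problem.»
HONEST DEPENDENCY (verbatim): «continuum YM on T⁴ ⇐ BetaPertH ∧ nine spine estimates (0/9 proved); BetaPertH ⇐ (D1) ∧ (D4) ∧ CAP+tail; G-an2-4 gates asym, D1 and NE2/3/4.»

## What (`ι` a finite index type — e.g. the fine bonds `(site, direction)` of a window; `Φ : ι → ι → ℝ` with `Φ q p = −Φ p q`; legs `L R : ι → ℝ`)
§1 `sum_sum_antisymm_diag_eq_zero` (`Σ_{p,q} Φ p q · (L p · L q) = 0` — equal legs: the diagonal coarse entry of the flux sandwich), **`two_mul_sum_sum_antisymm_eq`**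
   (`2·Σ Φ·L⊗R = Σ Φ·(L⊗R − R⊗L)ᵗ` — the commutator form), `sum_sum_antisymm_eq_half`.
§2 **`abs_sum_sum_antisymm_le_moduli`**: `|Σ_{p,q} Φ p q · (L p · R q)| ≤ ½·Σ_{p,q} |Φ p q|·(|L p − L q|·|R q| + |L q|·|R q − R p|)`; `abs_sum_sum_antisymm_le_of_moduli` — the same under
   displayed moduli `|L p − L q| ≤ ML p q`, `|R q − R p| ≤ MR p q` and sups `|L| ≤ HL`, `|R| ≤ HR`: `≤ ½·Σ_{p,q} |Φ p q|·(ML p q·HR + HL·MR p q)` — with `ML = G_L·‖p − q‖₁` on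
   parallel bonds this is the one-derivative gain E33 measures for the UNDRESSED column (R21: ×1.12 at d = 3 vs ×1.8–2.8 dressed); nothing here decides which pairs carry it.
[folklore]; NOTHING of (Q-R)∕(LT)∕(DIV)∕(DL)∕K-LL-4′ discharged; NEVER «G-an2-4 closed» as (CONV-C); NOT D1, NOT `BetaPertH`, NOT continuum, NOT Clay.  2026-08-22; no existing file touched.
-/

open Finset
open scoped BigOperators

namespace Summit.QuantumFields.BalabanUV.Beta.GAN24.AntisymmetricPairing

variable {ι : Type*} [Fintype ι] {Φ : ι → ι → ℝ} {L R : ι → ℝ}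

/-! ## §1 The commutator form -/

/-- [folklore] Swapping the summation variables and using antisymmetry: `Σ_{p,q} Φ p q·(L q·R p) = −Σ_{p,q} Φ p q·(L p·R q)`. -/
theorem sum_sum_antisymm_swap (hΦ : ∀ p q, Φ q p = -Φ p q) (L R : ι → ℝ) :
    ∑ p, ∑ q, Φ p q * (L q * R p) = -∑ p, ∑ q, Φ p q * (L p * R q) := by
  rw [Finset.sum_comm, ← Finset.sum_neg_distrib]
  refine Finset.sum_congr rfl fun p _ => ?_
  rw [← Finset.sum_neg_distrib]
  refine Finset.sum_congr rfl fun q _ => ?_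
  rw [hΦ p q]; ring

/-- [folklore] **EQUAL LEGS: THE PAIRING VANISHES** (the diagonal coarse entry of an antisymmetric flux sandwich with one column on both sides — leaf-01 g68 C-2, the OWNER's E33
exact check at D = 2, 3, 4): `Σ_{p,q} Φ p q·(L p·L q) = 0`. -/
theorem sum_sum_antisymm_diag_eq_zero (hΦ : ∀ p q, Φ q p = -Φ p q) (L : ι → ℝ) :
    ∑ p, ∑ q, Φ p q * (L p * L q) = 0 := by
  have h := sum_sum_antisymm_swap hΦ L L
  have e : ∑ p, ∑ q, Φ p q * (L q * L p) = ∑ p, ∑ q, Φ p q * (L p * L q) :=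
    Finset.sum_congr rfl fun p _ => Finset.sum_congr rfl fun q _ => by ring
  rw [e] at h
  linarith

/-- [folklore] **THE COMMUTATOR FORM**: `2·Σ_{p,q} Φ p q·(L p·R q) = Σ_{p,q} Φ p q·(L p·R q − L q·R p)`. -/
theorem two_mul_sum_sum_antisymm_eq (hΦ : ∀ p q, Φ q p = -Φ p q) (L R : ι → ℝ) :
    2 * ∑ p, ∑ q, Φ p q * (L p * R q) = ∑ p, ∑ q, Φ p q * (L p * R q - L q * R p) := by
  have h := sum_sum_antisymm_swap hΦ L R
  have e : ∑ p, ∑ q, Φ p q * (L p * R q - L q * R p) = ∑ p, ∑ q, Φ p q * (L p * R q) - ∑ p, ∑ q, Φ p q * (L q * R p) := by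
    rw [← Finset.sum_sub_distrib]
    refine Finset.sum_congr rfl fun p _ => ?_
    rw [← Finset.sum_sub_distrib]
    refine Finset.sum_congr rfl fun q _ => ?_
    ring
  rw [e, h]; ring

/-- [folklore] The halved form: `Σ_{p,q} Φ p q·(L p·R q) = ½·Σ_{p,q} Φ p q·(L p·R q − L q·R p)`. -/
theorem sum_sum_antisymm_eq_half (hΦ : ∀ p q, Φ q p = -Φ p q) (L R : ι → ℝ) :
    ∑ p, ∑ q, Φ p q * (L p * R q) = (1 / 2) * ∑ p, ∑ q, Φ p q * (L p * R q - L q * R p) := by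
  rw [← two_mul_sum_sum_antisymm_eq hΦ L R]; ring

/-! ## §2 The bound by the legs' moduli of variation across the band -/

omit [Fintype ι] in
/-- [folklore] The bracket, rearranged: `L p·R q − L q·R p = (L p − L q)·R q + L q·(R q − R p)`. -/
theorem bracket_eq (L R : ι → ℝ) (p q : ι) : L p * R q - L q * R p = (L p - L q) * R q + L q * (R q - R p) := by ring

/-- NOT IN PRINT; OUR BOOKKEEPING.  **THE PAIRING IS BOUNDED BY THE LEGS' VARIATION ACROSS THE PAIRS THE KERNEL COUPLES**:
`|Σ_{p,q} Φ p q·(L p·R q)| ≤ ½·Σ_{p,q} |Φ p q|·(|L p − L q|·|R q| + |L q|·|R q − R p|)` — no smoothness assumed; the right side is small exactly where the legs vary little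
between `p` and `q` on the support of `Φ`. -/
theorem abs_sum_sum_antisymm_le_moduli (hΦ : ∀ p q, Φ q p = -Φ p q) (L R : ι → ℝ) :
    |∑ p, ∑ q, Φ p q * (L p * R q)| ≤ (1 / 2) * ∑ p, ∑ q, |Φ p q| * (|L p - L q| * |R q| + |L q| * |R q - R p|) := by
  rw [sum_sum_antisymm_eq_half hΦ L R, abs_mul, abs_of_pos (by norm_num : (0 : ℝ) < 1 / 2)]
  refine mul_le_mul_of_nonneg_left ?_ (by norm_num)
  refine (Finset.abs_sum_le_sum_abs _ _).trans (Finset.sum_le_sum fun p _ => ?_)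
  refine (Finset.abs_sum_le_sum_abs _ _).trans (Finset.sum_le_sum fun q _ => ?_)
  rw [abs_mul, bracket_eq]
  refine mul_le_mul_of_nonneg_left ?_ (abs_nonneg _)
  calc |(L p - L q) * R q + L q * (R q - R p)| ≤ |(L p - L q) * R q| + |L q * (R q - R p)| := abs_add_le _ _
    _ = |L p - L q| * |R q| + |L q| * |R q - R p| := by rw [abs_mul, abs_mul]

/-- NOT IN PRINT; OUR BOOKKEEPING.  **THE SAME UNDER DISPLAYED MODULI AND SUPS**: `|L p − L q| ≤ ML p q`, `|R q − R p| ≤ MR p q` on the support pairs, `|L| ≤ HL`, `|R| ≤ HR` ⟹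
`|Σ_{p,q} Φ p q·(L p·R q)| ≤ ½·Σ_{p,q} |Φ p q|·(ML p q·HR + HL·MR p q)`.  (On PARALLEL bonds `ML p q = G_L·‖p − q‖₁` by a unit-gradient envelope — the one-derivative gain of a
fine-scale-smooth leg; on perpendicular pairs `ML` is whatever the two components allow — leaf-01 g68 C-3.) -/
theorem abs_sum_sum_antisymm_le_of_moduli (hΦ : ∀ p q, Φ q p = -Φ p q) {ML MR : ι → ι → ℝ} {HL HR : ℝ}
    (hML : ∀ p q, |L p - L q| ≤ ML p q) (hMR : ∀ p q, |R q - R p| ≤ MR p q) (hHL : ∀ q, |L q| ≤ HL) (hHR : ∀ q, |R q| ≤ HR) :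
    |∑ p, ∑ q, Φ p q * (L p * R q)| ≤ (1 / 2) * ∑ p, ∑ q, |Φ p q| * (ML p q * HR + HL * MR p q) := by
  refine (abs_sum_sum_antisymm_le_moduli hΦ L R).trans (mul_le_mul_of_nonneg_left ?_ (by norm_num))
  refine Finset.sum_le_sum fun p _ => Finset.sum_le_sum fun q _ => mul_le_mul_of_nonneg_left ?_ (abs_nonneg _)
  have h1 : |L p - L q| * |R q| ≤ ML p q * HR :=
    mul_le_mul (hML p q) (hHR q) (abs_nonneg _) ((abs_nonneg _).trans (hML p q))
  have h2 : |L q| * |R q - R p| ≤ HL * MR p q :=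
    mul_le_mul (hHL q) (hMR p q) (abs_nonneg _) ((abs_nonneg _).trans (hHL q))
  linarith

end Summit.QuantumFields.BalabanUV.Beta.GAN24.AntisymmetricPairing
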